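import Mathlib
import Literature.NumberTheory.ModularForms.SturmCongruence
import Literature.NumberTheory.Automorphic.UnboundedDenominators
import Literature.NumberTheory.EllipticCurves.ModularCurveKleinJ
import Literature.NumberTheory.EllipticCurves.KleinJIntegralQExpansion
import HarnessLib

/-!
# SturmCongruenceBound

Topic `Literature/NumberTheory/ModularForms`. Named literature fact(s) relocated by the gate from `Summits/Langlands/Langlands/Theorems/CapacityClassicalityIntegralOverconvergentIsCongruence.lean`
(accept-time relocation of `[cite]`d propositions written inline in a Summits proposal; human ruling 2026-08-15).
Sources: Sturm1987.

* `Literature.NumberTheory.ModularForms.Sturm1987_congruenceBound_Gamma1_modPrime`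
-/

namespace Literature.NumberTheory.ModularForms

open scoped MatrixGroups Manifold Topology
open UpperHalfPlane CongruenceSubgroup Metric PowerSeries
open Literature.NumberTheory.Automorphic
open Literature.NumberTheory.EllipticCurves Literature.NumberTheory.EllipticCurves.ModularForms

/-- **Sturm's congruence bound, mod `p`, for `Γ₁(N)` (named fact).** Sturm's theorem
(J. Sturm, *On the congruence of modular forms*, LNM 1240 (1987), Theorem 1): for a congruence
subgroup `Γ` of index `μ` in `SL₂(ℤ)`, a modular form `f ∈ M_k(Γ)` whose Fourier coefficients lie in
the ring of integers `𝒪` of a number field, and a prime `λ` of `𝒪`: if `a_n(f) ≡ 0 (mod λ)` for all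
`n ≤ kμ/12` then `a_n(f) ≡ 0 (mod λ)` for every `n`. Vendored here in the special case the consumer
needs (a weakening of the printed statement): `Γ = Γ₁(N)`, `𝒪 = ℤ`, `λ = (p)` with `p ∤ N`, `f` a
CUSP form, `μ = [SL₂(ℤ) : Γ₁(N)]` the full `SL₂`-index, coefficients read off Mathlib's
`qExpansion 1` (the cusp `∞` of `Γ₁(N)` has width `1`). Consumer: the sup-norm Sturm bound
`stub_supNormOfSturm` of crux `IntegralOverconvergentIsCongruence`.
[cite: Sturm1987, Thm. 1] [file NumberTheory/ModularForms/SturmCongruenceBound] -/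
def Sturm1987_congruenceBound_Gamma1_modPrime : Prop :=
  ∀ (N : ℕ) [NeZero N] (p : ℕ), p.Prime → ¬ p ∣ N →
    ∀ (k : ℤ) (f : CuspForm (CongruenceSubgroup.Gamma1 N) k) (z : ℕ → ℤ),
      (∀ n : ℕ, coeff n (qExpansion 1 ⇑f) = (z n : ℂ)) →
      (∀ n : ℕ, n ≤ (k * ((CongruenceSubgroup.Gamma1 N).index : ℤ)).toNat / 12 → (p : ℤ) ∣ z n) →
      ∀ n : ℕ, (p : ℤ) ∣ z n

/-- The cusp-form congruence bound `Sturm1987_congruenceBound_Gamma1_modPrime` is the special case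
`f ∈ S_k(Γ₁(N)) ⊆ M_k(Γ₁(N))` of the modular-form version `Sturm1987_congruence_modPrime_gamma1`
vendored in `Literature/NumberTheory/ModularForms/SturmCongruence.lean` (same weight, level, prime
`p ∤ N`, integer coefficients at `∞`, Sturm line `⌊k·[SL₂(ℤ):Γ₁(N)]/12⌋`): a cusp form is a modular
form with the same `q`-expansion (`Sturm1987_congruence_modPrime_gamma1.cuspForm`).  Hence ONE
discharge of `Sturm1987_congruence_modPrime_gamma1` settles both named facts (consumers: the
Katz–Sturm lines of cruxes `IntegralOverconvergentIsCongruence`, `EigenIntegralOverconvergentIsClassical`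
and `HilbertIntegralOverconvergentIsCongruence` of route `CapacityClassicality`).
[cite: Sturm1987, Thm. 1] -/
theorem Sturm1987_congruenceBound_Gamma1_modPrime_of_gamma1
    (h : Sturm1987_congruence_modPrime_gamma1) : Sturm1987_congruenceBound_Gamma1_modPrime :=
  fun N _ p hp hN k f z hz hb ↦
    Sturm1987_congruence_modPrime_gamma1.cuspForm h N p hp hN k f z hz hb

end Literature.NumberTheory.ModularForms
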